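import Literature.NumberTheory.Automorphic.IsomorphismGraphLieRoots
import Literature.NumberTheory.Automorphic.WeightClassCharacters
import Literature.NumberTheory.Automorphic.ChevalleyGroupAdjoint
import Literature.NumberTheory.Automorphic.TorusLieDual
import HarnessLib

/-!
# The graph group has no central torus: `Lie(H)_0 = Lie(T̃)`
(trunk T-AUTOMORPHIC, G25 AutomorphicL; step 7 of the graph proof of `chevalley_isomorphism_abstract`)

Sequel to `IsomorphismGraphLieRoots.lean` (for the graph group `H ≤ G × G'` of two connected
reductive groups with the same root datum over an algebraically closed field of characteristic
`0`: `Lie(H)_α` is a line with both blocks non-zero for every root `α`, and on `Lie(H)_0` the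
differentials of the simple roots of `G` and `G'` agree) and `WeightClassCharacters.lean` (the
determinant characters `projDet Π_i` on the weight classes of `kⁿ` modulo the root lattice, their
class weights `λ_i` with `⟨λ_i, α^∨⟩ = 0`, and the lattice lemmas). Here the weight-zero part of
`Lie(H)` is shown to be a graph as well (namespace `Literature.NumberTheory.Automorphic`):

* **`exists_mem_lieAlgebraGL_graphTorus_toBlocks₁₁_eq`** — `Lie(T̃) → Lie(T)`, `B ↦ B₁₁`, is onto
  (it is injective, `IsomorphismGraphLieGens`, and both sides have dimension `rank X*`: Springer
  4.4.13, `Lie(T) ≅ Hom(X*(T), k)`, `lieTorusDual_bijective`);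
* **`charOfWeight_root_eq_one_of_inr_mem`** — if `(1, t') ∈ H` with `t' ∈ T'` then every root
  kills `t'`: otherwise `(1, t') ũ_s(x) (1, t')⁻¹ ũ_s(-x) = (1, u'_s((α'_s(t') - 1) x))` puts
  `1 × U'_{α_s}` inside `H` and `(0, e'_s)` inside `Lie(H)_{α_s}`, against the root-line property;
* **`graphGroup_le_detRel`**, **`charOfWeight_eq_one_of_mem_inf`** — for exponents `a, b` with
  `∑ a_i λ_i = μ = ∑ b_j λ'_j` the relation `∏ projDet Π_i (g₁₁)^{a_i} = ∏ projDet Π'_j (g₂₂)^{b_j}`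
  holds on the generators of `H` (on `T̃` both sides are `χ_μ(t) = χ'_μ(f_T t)`; on `ũ_s, ṽ_s` both
  are `1`), hence on `H` (the relation together with commutation with the projectors defines a
  subgroup); at `(1, t')` it reads `χ'_μ(t') = 1` for `μ ∈ L ∩ L'`;
* **`exists_forall_charOfWeight_zpow_eq_one`** — by the lattice lemmas every weight `x` has
  `M x ∈ ℤR + L ∩ L'` for some `M ≠ 0`, so `χ'_x(t')^M = 1` for all such `t'`;
* **`eq_zero_of_mem_lieAlgebraGL_graphGroup_zero_of_toBlocks₁₁`** — if `A = (0, z') ∈ Lie(H)_0`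
  then `z' = 0`: `z' ∈ Lie(T')` is semisimple; after diagonalising `T'`, Chevalley's hull torus of
  `diag(0, z')` (`hullTorus_le_of_diagonal_mem_lieAlgebraGL`) lies in `H`, inside `1 × T'`, and its
  monomial characters `t ↦ t_{jj}^M` are trivial by the previous step, whence `z'_{jj} = 0`
  (`zdot_eq_zero_of_forall_mem_hullTorus`); and the symmetric statement
  `eq_zero_of_mem_lieAlgebraGL_graphGroup_zero_of_toBlocks₂₂` (through the surjectivity of
  `Lie(T̃) → Lie(T)`).

Everything is proved; no named fact is introduced. (This replaces, in the graph method of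
Humphreys §33 / Steinberg, the appeal to the structure of the derived group: the adjoint action
does not see a central torus `1 × S' ≤ H`, the determinant characters of the two representations
do.)

## References

* [SpringerLAG1998] T. A. Springer, *Linear Algebraic Groups*, 2nd ed. (1998), 3.2.3, 4.4.13,
  8.1.8, Theorem 9.6.2.
* [Humphreys1975] J. E. Humphreys, *Linear Algebraic Groups*, GTM 21 (1975), §27.5, §33.
* A. Borel, *Linear Algebraic Groups*, 2nd ed. (1991), II §7 (algebraic hulls).
-/

noncomputable section

open scoped MatrixGroups IsMulCommutative
open Matrix

namespace Literature.NumberTheory.Automorphic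

variable {k : Type*} [Field k] {n n' : Type*} [Fintype n] [DecidableEq n] [Fintype n'] [DecidableEq n']
variable {ι X Y : Type*} [AddCommGroup X] [AddCommGroup Y]
variable {G T : Subgroup (GL n k)} {G' T' : Subgroup (GL n' k)}
variable [IsMulCommutative ↥T] [IsMulCommutative ↥T']
variable {P : RootPairing ι ℤ X Y}
variable {eX : Additive ↥(characterLattice T) ≃+ X} {eY : Additive ↥(cocharacterLattice T) ≃+ Y}
variable {eX' : Additive ↥(characterLattice T') ≃+ X} {eY' : Additive ↥(cocharacterLattice T') ≃+ Y}

/-! ### `Lie(T̃) → Lie(T)` is onto -/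

section TorusLie

/-- Precomposition with an isomorphism of abelian groups, as a `k`-linear isomorphism of the
spaces of additive maps into `k`. [folklore] -/
def addMonoidHomCongrLinearEquiv {A B : Type*} [AddCommGroup A] [AddCommGroup B] (e : A ≃+ B) :
    (A →+ k) ≃ₗ[k] (B →+ k) where
  toFun f := f.comp e.symm.toAddMonoidHom
  invFun g := g.comp e.toAddMonoidHom
  map_add' f g := by ext; rfl
  map_smul' c f := by ext; rfl
  left_inv f := by ext a; simp
  right_inv g := by ext b; simp

variable [IsAlgClosed k] (eX eX') (hT : IsTorusSubgroup T) (hT' : IsTorusSubgroup T')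

/-- `x ↦ χ̃_x` as an additive homomorphism `X → X*(T̃)`. [folklore] -/
def graphCharAddHom : X →+ Additive ↥(characterLattice (graphTorus eX eX' hT hT')) where
  toFun x := Additive.ofMul (graphCharMem eX eX' hT hT' x)
  map_zero' := by
    apply Additive.toMul.injective
    apply Subtype.ext
    rw [toMul_ofMul, coe_graphCharMem, graphChar_zero]
    rfl
  map_add' x y := by
    apply Additive.toMul.injective
    apply Subtype.ext
    rw [toMul_ofMul, toMul_add, toMul_ofMul, toMul_ofMul, coe_graphCharMem, graphChar_add]
    rfl

/-- Unfolding `graphCharAddHom`. [folklore] -/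
lemma toMul_graphCharAddHom (x : X) :
    ((Additive.toMul (graphCharAddHom eX eX' hT hT' x) : ↥(characterLattice (graphTorus eX eX' hT hT'))) :
      ↥(graphTorus eX eX' hT hT') →* kˣ) = graphChar eX eX' hT hT' x :=
  rfl

/-- **`X ≃ X*(T̃)`**, `x ↦ χ̃_x` (`graphChar_injective`, `exists_graphChar_eq`). [folklore] -/
def graphCharAddEquiv : X ≃+ Additive ↥(characterLattice (graphTorus eX eX' hT hT')) :=
  AddEquiv.ofBijective (graphCharAddHom eX eX' hT hT')
    ⟨fun x y hxy => graphChar_injective eX eX' hT hT' (by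
        rw [← toMul_graphCharAddHom, ← toMul_graphCharAddHom]
        exact congrArg (fun χ => (Additive.toMul χ).1) hxy),
      fun χ => by
        obtain ⟨x, hx⟩ := exists_graphChar_eq eX eX' hT hT' (χ := (Additive.toMul χ).1) (Additive.toMul χ).2
        refine ⟨x, Additive.toMul.injective (Subtype.ext ?_)⟩
        rw [toMul_graphCharAddHom]
        exact hx⟩

/-- **`Lie(T̃) → Lie(T)`, `B ↦ B₁₁`, is onto.** It is injective
(`eq_of_mem_lieAlgebraGL_graphTorus_of_toBlocks₁₁_eq`) and `dim Lie(T̃) = dim Hom(X*(T̃), k) =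
dim Hom(X*(T), k) = dim Lie(T)` (`lieTorusDual_bijective`, Springer 4.4.13, and `X*(T̃) ≅ X ≅ X*(T)`).
[cite: SpringerLAG1998, 4.4.13] -/
theorem exists_mem_lieAlgebraGL_graphTorus_toBlocks₁₁_eq {z : Matrix n n k} (hz : z ∈ lieAlgebraGL T) :
    ∃ B ∈ lieAlgebraGL (graphTorus eX eX' hT hT'), B.toBlocks₁₁ = z := by
  have hTT : IsTorusSubgroup (graphTorus eX eX' hT hT') := isTorusSubgroup_graphTorus eX eX' hT hT'
  haveI : Module.Finite k ↥(lieAlgebraGL T) := hT.1.finrank_lieAlgebraGL_eq.1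
  haveI : Module.Finite k ↥(lieAlgebraGL (graphTorus eX eX' hT hT')) := hTT.1.finrank_lieAlgebraGL_eq.1
  let Φ : ↥(lieAlgebraGL (graphTorus eX eX' hT hT')) →ₗ[k] ↥(lieAlgebraGL T) :=
    { toFun := fun B => ⟨(B : Matrix (n ⊕ n') (n ⊕ n') k).toBlocks₁₁,
        (eq_fromBlocks_of_mem_lieAlgebraGL_of_le (graphTorus_le_prodBlock eX eX' hT hT') B.2).2.1⟩
      map_add' := fun B C => by ext i j; rfl
      map_smul' := fun c B => by ext i j; rfl }
  have hinj : Function.Injective Φ := by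
    intro B C hBC
    apply Subtype.ext
    exact eq_of_mem_lieAlgebraGL_graphTorus_of_toBlocks₁₁_eq eX eX' hT hT' B.2 C.2 (congrArg Subtype.val hBC)
  have hrank : Module.finrank k ↥(lieAlgebraGL (graphTorus eX eX' hT hT')) = Module.finrank k ↥(lieAlgebraGL T) := by
    rw [(LinearEquiv.ofBijective (lieTorusDual (graphTorus eX eX' hT hT')) (lieTorusDual_bijective hTT)).finrank_eq,
      (LinearEquiv.ofBijective (lieTorusDual T) (lieTorusDual_bijective hT)).finrank_eq]
    exact (addMonoidHomCongrLinearEquiv (k := k)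
      ((graphCharAddEquiv eX eX' hT hT').symm.trans eX.symm)).finrank_eq
  obtain ⟨B, hB⟩ := (LinearMap.injective_iff_surjective_of_finrank_eq_finrank hrank).1 hinj ⟨z, hz⟩
  exact ⟨B, B.2, congrArg Subtype.val hB⟩

/-- **`Lie(T̃) → Lie(T')`, `B ↦ B₂₂`, is onto** (same proof on the second block). [cite: SpringerLAG1998, 4.4.13] -/
theorem exists_mem_lieAlgebraGL_graphTorus_toBlocks₂₂_eq {z' : Matrix n' n' k} (hz' : z' ∈ lieAlgebraGL T') :
    ∃ B ∈ lieAlgebraGL (graphTorus eX eX' hT hT'), B.toBlocks₂₂ = z' := by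
  have hTT : IsTorusSubgroup (graphTorus eX eX' hT hT') := isTorusSubgroup_graphTorus eX eX' hT hT'
  haveI : Module.Finite k ↥(lieAlgebraGL T') := hT'.1.finrank_lieAlgebraGL_eq.1
  haveI : Module.Finite k ↥(lieAlgebraGL (graphTorus eX eX' hT hT')) := hTT.1.finrank_lieAlgebraGL_eq.1
  let Φ : ↥(lieAlgebraGL (graphTorus eX eX' hT hT')) →ₗ[k] ↥(lieAlgebraGL T') :=
    { toFun := fun B => ⟨(B : Matrix (n ⊕ n') (n ⊕ n') k).toBlocks₂₂,
        (eq_fromBlocks_of_mem_lieAlgebraGL_of_le (graphTorus_le_prodBlock eX eX' hT hT') B.2).2.2⟩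
      map_add' := fun B C => by ext i j; rfl
      map_smul' := fun c B => by ext i j; rfl }
  have hinj : Function.Injective Φ := by
    intro B C hBC
    apply Subtype.ext
    exact eq_of_mem_lieAlgebraGL_graphTorus_of_toBlocks₂₂_eq eX eX' hT hT' B.2 C.2 (congrArg Subtype.val hBC)
  have hrank : Module.finrank k ↥(lieAlgebraGL (graphTorus eX eX' hT hT')) = Module.finrank k ↥(lieAlgebraGL T') := by
    rw [(LinearEquiv.ofBijective (lieTorusDual (graphTorus eX eX' hT hT')) (lieTorusDual_bijective hTT)).finrank_eq,
      (LinearEquiv.ofBijective (lieTorusDual T') (lieTorusDual_bijective hT')).finrank_eq]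
    exact (addMonoidHomCongrLinearEquiv (k := k)
      ((graphCharAddEquiv eX eX' hT hT').symm.trans eX'.symm)).finrank_eq
  obtain ⟨B, hB⟩ := (LinearMap.injective_iff_surjective_of_finrank_eq_finrank hrank).1 hinj ⟨z', hz'⟩
  exact ⟨B, B.2, congrArg Subtype.val hB⟩

end TorusLie

/-! ### Roots kill the second components of `H ∩ (1 × T')` -/

section RootKill

variable [IsAlgClosed k] [CharZero k] (h : IsRootDatumOf G T P eX eY) (h' : IsRootDatumOf G' T' P eX' eY')
  (b : P.Base) (hG : IsConnectedReductive G) (hTm : IsMaximalTorusIn T G)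
  (hG' : IsConnectedReductive G') (hTm' : IsMaximalTorusIn T' G')

variable [Finite ι] [P.IsReduced]

include hG hG' in
/-- **If `(1, t') ∈ H` with `t' ∈ T'`, then `χ'_{α_s}(t') = 1` for every simple root `α_s`.**
Otherwise, with `c = χ'_{α_s}(t') ≠ 1`, the commutator `(1, t') ũ_s(x) (1, t')⁻¹ ũ_s(-x) =
(1, u'_s((c - 1) x))` shows `(1, u'_s(y)) = exp (y · diag(0, e'_s)) ∈ H` for all `y`, so
`diag(0, e'_s) ∈ Lie(H)_{α_s}` (`mem_lieAlgebraGL_of_expHom_mem`), contradicting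
`eq_zero_of_mem_lieAlgebraGL_graphGroup_root_of_toBlocks`. [folklore] -/
theorem charOfWeight_root_eq_one_of_inr_mem (s : ↥b.support) {t' : ↥T'}
    (ht' : blockDiagGL ((1 : GL n k), (t' : GL n' k)) ∈ graphGroup h h' hTm.2.1 hTm'.2.1 (b.support : Set ι)) :
    charOfWeight eX' (P.root (s : ι)) t' = 1 := by
  by_contra hc
  have hGa' : IsAlgebraicSubgroup G' := hG'.1.1
  set H := graphGroup h h' hTm.2.1 hTm'.2.1 (b.support : Set ι) with hH
  set c : kˣ := charOfWeight eX' (P.root (s : ι)) t' with hcdef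
  have hc1 : (c : k) - 1 ≠ 0 := sub_ne_zero.2 fun e => hc (Units.val_eq_one.1 e)
  -- Step 1: `(1, u'_s(y)) ∈ H` for all `y`
  have hmem : ∀ y : k, blockDiagGL ((1 : GL n k),
      (((h'.rootSL2 s).comp unipotentUpperSL2 (Multiplicative.ofAdd y) : ↥G') : GL n' k)) ∈ H := by
    intro y
    set x : k := y / ((c : k) - 1) with hx
    have hy : (c : k) * x + -x = y := by rw [hx]; field_simp; ring
    have hu' := (h'.isRootHom_rootSL2_upper s).2.2 t' x
    have eu' := congrArg (fun g : ↥G' => (g : GL n' k)) hu'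
    simp only [Subgroup.coe_mul, Subgroup.coe_inv, Subgroup.coe_inclusion] at eu'
    have e1 : blockDiagGL ((1 : GL n k), (t' : GL n' k)) * graphUpperGL h h' s (Multiplicative.ofAdd x) *
        (blockDiagGL ((1 : GL n k), (t' : GL n' k)))⁻¹ * graphUpperGL h h' s (Multiplicative.ofAdd (-x)) =
        blockDiagGL ((1 : GL n k),
          (((h'.rootSL2 s).comp unipotentUpperSL2 (Multiplicative.ofAdd y) : ↥G') : GL n' k)) := by
      rw [graphUpperGL_apply, graphUpperGL_apply, ← map_inv, ← map_mul, ← map_mul, ← map_mul]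
      congr 1
      refine Prod.ext ?_ ?_
      · simp only [Prod.fst_mul, Prod.fst_inv, one_mul, inv_one, mul_one]
        rw [← Subgroup.coe_mul, ← map_mul, ← ofAdd_add, add_neg_cancel, ofAdd_zero, map_one, Subgroup.coe_one]
      · simp only [Prod.snd_mul, Prod.snd_inv]
        rw [eu', ← Subgroup.coe_mul, ← map_mul, ← ofAdd_add, hy]
    have hprod : blockDiagGL ((1 : GL n k), (t' : GL n' k)) * graphUpperGL h h' s (Multiplicative.ofAdd x) *
        (blockDiagGL ((1 : GL n k), (t' : GL n' k)))⁻¹ * graphUpperGL h h' s (Multiplicative.ofAdd (-x)) ∈ H :=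
      H.mul_mem (H.mul_mem (H.mul_mem ht' (graphUpperGL_mem_graphGroup h h' _ _ _ s.2 _)) (H.inv_mem ht'))
        (graphUpperGL_mem_graphGroup h h' _ _ _ s.2 _)
    rwa [e1] at hprod
  -- Step 2: `(1, u'_s(y)) = exp (y · diag(0, e'_s))`
  have hnil' : IsNilpotent (h'.rootE s) := h'.isNilpotent_rootE hTm'.2.1 s
  have hnil : IsNilpotent (fromBlocks (0 : Matrix n n k) 0 0 (h'.rootE s)) :=
    isNilpotent_fromBlocks_zero IsNilpotent.zero hnil'
  have hexp : ∀ w : Multiplicative k, expHom (fromBlocks (0 : Matrix n n k) 0 0 (h'.rootE s)) hnil w ∈ H := by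
    intro w
    have e0 : expHom (0 : Matrix n n k) IsNilpotent.zero w = 1 := by
      apply Units.ext
      rw [coe_expHom_apply, smul_zero, IsNilpotent.exp_zero, Units.val_one]
    rw [expHom_fromBlocks IsNilpotent.zero hnil', e0, ← ofAdd_toAdd w,
      ← h'.coe_rootSL2_upper hGa' hTm'.2.1 s (Multiplicative.toAdd w)]
    exact hmem _
  have hLie : fromBlocks (0 : Matrix n n k) 0 0 (h'.rootE s) ∈ lieAlgebraGL H :=
    mem_lieAlgebraGL_of_expHom_mem hnil hexp
  -- Step 3: contradiction with the root-line property
  have hw : fromBlocks (0 : Matrix n n k) 0 0 (h'.rootE s) ∈ grW eX eX' hTm.2.1 hTm'.2.1 (P.root (s : ι)) :=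
    (fromBlocks_mem_weightSpaceGL_graphTorus_iff eX eX' hTm.2.1 hTm'.2.1 (P.root (s : ι)) 0 (h'.rootE s)).2
      ⟨Submodule.zero_mem _, (h'.rootE_mem s).2⟩
  have h0 := eq_zero_of_mem_lieAlgebraGL_graphGroup_root_of_toBlocks h h' b hG hTm hG' hTm' s hLie hw
    (Or.inl (by ext i j; rfl))
  have he : h'.rootE s = 0 := by
    have := congrArg Matrix.toBlocks₂₂ h0
    rwa [toBlocks_fromBlocks₂₂] at this
  exact h'.rootE_ne_zero s he

include hG hG' in
/-- Hence every element of the root lattice kills such `t'`. [folklore] -/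
theorem charOfWeight_eq_one_of_inr_mem_of_mem_rootSpan {t' : ↥T'}
    (ht' : blockDiagGL ((1 : GL n k), (t' : GL n' k)) ∈ graphGroup h h' hTm.2.1 hTm'.2.1 (b.support : Set ι))
    {x : X} (hx : x ∈ P.rootSpan ℤ) : charOfWeight eX' x t' = 1 := by
  rw [← b.span_root_support] at hx
  induction hx using Submodule.span_induction with
  | mem y hy =>
    obtain ⟨s, hs, rfl⟩ := hy
    exact charOfWeight_root_eq_one_of_inr_mem h h' b hG hTm hG' hTm' ⟨s, hs⟩ ht'
  | zero => simp [charOfWeight]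
  | add y z _ _ hy hz => rw [charOfWeight_add', MonoidHom.mul_apply, hy, hz, mul_one]
  | smul c y _ hy => rw [charOfWeight_zsmul, MonoidHom.zpow_apply, hy, one_zpow]

end RootKill

/-! ### The determinant-character relation on `H` -/

section DetRelation

variable [IsAlgClosed k]

section OneGroup

variable {m : Type*} [Fintype m] [DecidableEq m] {T₀ : Subgroup (GL m k)}
  (e₀ : Additive ↥(characterLattice T₀) ≃+ X) (hT₀ : IsTorusSubgroup T₀) (R : Submodule ℤ X)

/-- `D_a(x) = ∏_i projDet Π_i (x) ^ a_i`. [folklore] -/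
def detProd (a : m → ℤ) (x : Matrix m m k) : k := ∏ i, projDet (classProj e₀ hT₀ R i) x ^ a i

/-- `D_a(1) = 1`. [folklore] -/
lemma detProd_one (a : m → ℤ) : detProd e₀ hT₀ R a 1 = 1 := by
  simp [detProd]

/-- `D_a(x y) = D_a(x) D_a(y)` when `y` commutes with the projectors. [folklore] -/
lemma detProd_mul (a : m → ℤ) (x : Matrix m m k) {y : Matrix m m k}
    (hy : ∀ i, y * classProj e₀ hT₀ R i = classProj e₀ hT₀ R i * y) :
    detProd e₀ hT₀ R a (x * y) = detProd e₀ hT₀ R a x * detProd e₀ hT₀ R a y := by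
  unfold detProd
  rw [← Finset.prod_mul_distrib]
  refine Finset.prod_congr rfl fun i _ => ?_
  rw [projDet_mul (classProj_mul_self e₀ hT₀ R i) (hy i), mul_zpow]

omit [IsAlgClosed k] in
/-- Commutation passes to the inverse. [folklore] -/
lemma coe_inv_mul_comm_of (g : GL m k) {Q : Matrix m m k} (hg : (g : Matrix m m k) * Q = Q * g) :
    ((g⁻¹ : GL m k) : Matrix m m k) * Q = Q * ((g⁻¹ : GL m k) : Matrix m m k) := by
  calc ((g⁻¹ : GL m k) : Matrix m m k) * Q
      = ((g⁻¹ : GL m k) : Matrix m m k) * Q * ((g : Matrix m m k) * ((g⁻¹ : GL m k) : Matrix m m k)) := by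
        rw [Units.mul_inv, Matrix.mul_one]
    _ = ((g⁻¹ : GL m k) : Matrix m m k) * (Q * (g : Matrix m m k)) * ((g⁻¹ : GL m k) : Matrix m m k) := by
        simp only [Matrix.mul_assoc]
    _ = Q * ((g⁻¹ : GL m k) : Matrix m m k) := by
        rw [← hg, ← Matrix.mul_assoc, Units.inv_mul, Matrix.one_mul]

/-- `D_a(g⁻¹) = D_a(g)⁻¹` when `g` commutes with the projectors. [folklore] -/
lemma detProd_coe_inv (a : m → ℤ) (g : GL m k)
    (hg : ∀ i, (g : Matrix m m k) * classProj e₀ hT₀ R i = classProj e₀ hT₀ R i * g) :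
    detProd e₀ hT₀ R a ((g⁻¹ : GL m k) : Matrix m m k) = (detProd e₀ hT₀ R a g)⁻¹ := by
  unfold detProd
  rw [← Finset.prod_inv_distrib]
  refine Finset.prod_congr rfl fun i _ => ?_
  rw [← inv_zpow]
  congr 1
  exact eq_inv_of_mul_eq_one_right
    (projDet_mul_projDet_inv (classProj_mul_self e₀ hT₀ R i) g (coe_inv_mul_comm_of g (hg i)))

/-- **`D_a(t) = χ_{∑ a_i λ_i}(t)` on the torus.** [folklore] -/
lemma detProd_torus (a : m → ℤ) (t : ↥T₀) :
    detProd e₀ hT₀ R a ((t : GL m k) : Matrix m m k) =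
      ((charOfWeight e₀ (∑ i, a i • classWt e₀ hT₀ R i) t : kˣ) : k) := by
  unfold detProd
  rw [charOfWeight_finset_sum, MonoidHom.finsetProd_apply, Units.coe_prod]
  refine Finset.prod_congr rfl fun i _ => ?_
  rw [charOfWeight_zsmul, MonoidHom.zpow_apply, Units.val_zpow_eq_zpow_val, projDet_classProj_torus]

end OneGroup

variable (eX eX') (hT : IsTorusSubgroup T) (hT' : IsTorusSubgroup T') (R : Submodule ℤ X)

/-- The subgroup of `GL_n × GL_{n'}` of pairs commuting with the class projectors of both groups
and satisfying the relation `D_a(g₁) = D'_b(g₂)`. [folklore] -/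
def detRelSubgroup (a : n → ℤ) (a' : n' → ℤ) : Subgroup (GL n k × GL n' k) where
  carrier := {p | (∀ i, (p.1 : Matrix n n k) * classProj eX hT R i = classProj eX hT R i * p.1) ∧
    (∀ j, (p.2 : Matrix n' n' k) * classProj eX' hT' R j = classProj eX' hT' R j * p.2) ∧
    detProd eX hT R a p.1 = detProd eX' hT' R a' p.2}
  one_mem' := ⟨fun i => by simp, fun j => by simp, by
    simp only [Prod.fst_one, Prod.snd_one, Units.val_one, detProd_one]⟩
  mul_mem' := by
    rintro p q ⟨hp₁, hp₂, hp⟩ ⟨hq₁, hq₂, hq⟩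
    refine ⟨fun i => ?_, fun j => ?_, ?_⟩
    · rw [Prod.fst_mul, Units.val_mul, Matrix.mul_assoc, hq₁, ← Matrix.mul_assoc, hp₁, Matrix.mul_assoc]
    · rw [Prod.snd_mul, Units.val_mul, Matrix.mul_assoc, hq₂, ← Matrix.mul_assoc, hp₂, Matrix.mul_assoc]
    · rw [Prod.fst_mul, Prod.snd_mul, Units.val_mul, Units.val_mul, detProd_mul _ _ _ _ _ hq₁,
        detProd_mul _ _ _ _ _ hq₂, hp, hq]
  inv_mem' := by
    rintro p ⟨hp₁, hp₂, hp⟩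
    refine ⟨fun i => ?_, fun j => ?_, ?_⟩
    · rw [Prod.fst_inv]; exact coe_inv_mul_comm_of _ (hp₁ i)
    · rw [Prod.snd_inv]; exact coe_inv_mul_comm_of _ (hp₂ j)
    · rw [Prod.fst_inv, Prod.snd_inv, detProd_coe_inv _ _ _ _ _ hp₁, detProd_coe_inv _ _ _ _ _ hp₂, hp]

variable {eX eX' hT hT' R}

variable [CharZero k] (h : IsRootDatumOf G T P eX eY) (h' : IsRootDatumOf G' T' P eX' eY')
  (hGa : IsAlgebraicSubgroup G) (hGa' : IsAlgebraicSubgroup G')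

include hGa hGa' in
/-- **The relation `D_a(g₁) = D'_b(g₂)` holds on the graph group** whenever
`∑ a_i λ_i = ∑ b_j λ'_j` and `R` contains the roots: it holds on `T̃` (both sides equal
`χ_μ(t) = χ'_μ(f_T t)`, `detProd_torus`, `charOfWeight_torusIsoOfWeights`) and on `ũ_s`, `ṽ_s`
(both sides `1`, `projDet_classProj_rootSL2`), and these generate `H`. [folklore] -/
theorem graphGroup_le_detRel (hR : ∀ s, P.root s ∈ R) (S : Set ι) {a : n → ℤ} {a' : n' → ℤ}
    (hab : ∑ i, a i • classWt eX hT R i = ∑ j, a' j • classWt eX' hT' R j) :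
    graphGroup h h' hT hT' S ≤ (detRelSubgroup eX eX' hT hT' R a a').map blockDiagGL := by
  refine sup_le ?_ (iSup_le fun s => sup_le ?_ ?_)
  · rintro _ ⟨t, rfl⟩
    refine ⟨((t : GL n k), ((torusIsoOfWeights eX eX' hT hT' t : ↥T') : GL n' k)), ⟨fun i => ?_, fun j => ?_, ?_⟩, rfl⟩
    · exact classProj_torus_comm eX hT R i t
    · exact classProj_torus_comm eX' hT' R j _
    · change detProd eX hT R a ((t : GL n k) : Matrix n n k) =
        detProd eX' hT' R a' (((torusIsoOfWeights eX eX' hT hT' t : ↥T') : GL n' k) : Matrix n' n' k)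
      rw [detProd_torus, detProd_torus, ← hab, charOfWeight_torusIsoOfWeights]
  · rintro _ ⟨x, rfl⟩
    have H1 := fun i => projDet_classProj_rootSL2 h hGa hT R hR i s (unipotentUpperSL2 x)
    have H2 := fun j => projDet_classProj_rootSL2 h' hGa' hT' R hR j s (unipotentUpperSL2 x)
    refine ⟨((((h.rootSL2 s) (unipotentUpperSL2 x) : ↥G) : GL n k),
      (((h'.rootSL2 s) (unipotentUpperSL2 x) : ↥G') : GL n' k)), ⟨fun i => (H1 i).1, fun j => (H2 j).1, ?_⟩, rfl⟩
    change detProd eX hT R a ((((h.rootSL2 s) (unipotentUpperSL2 x) : ↥G) : GL n k) : Matrix n n k) =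
      detProd eX' hT' R a' ((((h'.rootSL2 s) (unipotentUpperSL2 x) : ↥G') : GL n' k) : Matrix n' n' k)
    unfold detProd
    rw [Finset.prod_eq_one fun i _ => by rw [(H1 i).2, one_zpow],
      Finset.prod_eq_one fun j _ => by rw [(H2 j).2, one_zpow]]
  · rintro _ ⟨x, rfl⟩
    have H1 := fun i => projDet_classProj_rootSL2 h hGa hT R hR i s (unipotentLowerSL2 x)
    have H2 := fun j => projDet_classProj_rootSL2 h' hGa' hT' R hR j s (unipotentLowerSL2 x)
    refine ⟨((((h.rootSL2 s) (unipotentLowerSL2 x) : ↥G) : GL n k),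
      (((h'.rootSL2 s) (unipotentLowerSL2 x) : ↥G') : GL n' k)), ⟨fun i => (H1 i).1, fun j => (H2 j).1, ?_⟩, rfl⟩
    change detProd eX hT R a ((((h.rootSL2 s) (unipotentLowerSL2 x) : ↥G) : GL n k) : Matrix n n k) =
      detProd eX' hT' R a' ((((h'.rootSL2 s) (unipotentLowerSL2 x) : ↥G') : GL n' k) : Matrix n' n' k)
    unfold detProd
    rw [Finset.prod_eq_one fun i _ => by rw [(H1 i).2, one_zpow],
      Finset.prod_eq_one fun j _ => by rw [(H2 j).2, one_zpow]]

include h hGa hGa' in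
/-- **`χ'_μ(t') = 1` for `(1, t') ∈ H`, `t' ∈ T'`, and `μ` in both class-weight lattices.**
[folklore] -/
theorem charOfWeight_eq_one_of_mem_inf (hR : ∀ s, P.root s ∈ R) (S : Set ι) {t' : ↥T'}
    (ht' : blockDiagGL ((1 : GL n k), (t' : GL n' k)) ∈ graphGroup h h' hT hT' S) {μ : X}
    (hμ : μ ∈ Submodule.span ℤ (Set.range (classWt eX hT R : n → X)))
    (hμ' : μ ∈ Submodule.span ℤ (Set.range (classWt eX' hT' R : n' → X))) :
    charOfWeight eX' μ t' = 1 := by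
  obtain ⟨a, ha⟩ := (Submodule.mem_span_range_iff_exists_fun ℤ).1 hμ
  obtain ⟨a', ha'⟩ := (Submodule.mem_span_range_iff_exists_fun ℤ).1 hμ'
  obtain ⟨p, hp, hpe⟩ := graphGroup_le_detRel h h' hGa hGa' hR S (ha.trans ha'.symm) ht'
  have hp1 : p = ((1 : GL n k), (t' : GL n' k)) := blockDiagGL_injective hpe
  subst hp1
  obtain ⟨-, -, hrel⟩ := hp
  change detProd eX hT R a ((1 : GL n k) : Matrix n n k) = detProd eX' hT' R a' ((t' : GL n' k) : Matrix n' n' k) at hrel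
  rw [Units.val_one, detProd_one, detProd_torus, ha'] at hrel
  exact Units.val_eq_one.1 hrel.symm

end DetRelation

/-! ### `Lie(H)_0` is a graph -/

section Central

variable [IsAlgClosed k] [CharZero k] (h : IsRootDatumOf G T P eX eY) (h' : IsRootDatumOf G' T' P eX' eY')
  (b : P.Base) (hG : IsConnectedReductive G) (hTm : IsMaximalTorusIn T G)
  (hG' : IsConnectedReductive G') (hTm' : IsMaximalTorusIn T' G')

variable [Finite ι] [P.IsReduced]

include hG hG' in
/-- **Every weight has a power trivial on `H ∩ (1 × T')`**: for each `x ∈ X` there is `M ≠ 0` with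
`χ'_x(t')^M = 1` whenever `(1, t') ∈ H`, `t' ∈ T'` — since `M x ∈ ℤR + L ∩ L'`
(`exists_smul_mem_sup_inf` with `pairing_classWt_coroot`, `exists_smul_mem_span_classWt`,
`addMonoidHom_eq_zero_of_forall_classWt`), the root lattice kills `t'`
(`charOfWeight_eq_one_of_inr_mem_of_mem_rootSpan`) and so does `L ∩ L'`
(`charOfWeight_eq_one_of_mem_inf`). [folklore] -/
theorem exists_forall_charOfWeight_zpow_eq_one (x : X) : ∃ M : ℤ, M ≠ 0 ∧ ∀ t' : ↥T',
    blockDiagGL ((1 : GL n k), (t' : GL n' k)) ∈ graphGroup h h' hTm.2.1 hTm'.2.1 (b.support : Set ι) →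
      charOfWeight eX' x t' ^ M = 1 := by
  set R : Submodule ℤ X := P.rootSpan ℤ with hRdef
  have hR : ∀ s, P.root s ∈ R := fun s => Submodule.subset_span ⟨s, rfl⟩
  set L : Submodule ℤ X := Submodule.span ℤ (Set.range (classWt eX hTm.2.1 R : n → X)) with hLdef
  set L' : Submodule ℤ X := Submodule.span ℤ (Set.range (classWt eX' hTm'.2.1 R : n' → X)) with hL'def
  have hLC : L ≤ corootOrth P := by
    rw [hLdef, Submodule.span_le]
    rintro _ ⟨i, rfl⟩
    exact mem_corootOrth_iff.2 fun s => pairing_classWt_coroot h hG.1.1 hTm.2.1 R hR i s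
  have hLC' : ∀ j, classWt eX' hTm'.2.1 R j ∈ corootOrth P := fun j =>
    mem_corootOrth_iff.2 fun s => pairing_classWt_coroot h' hG'.1.1 hTm'.2.1 R hR j s
  obtain ⟨M, hM0, hM⟩ := exists_smul_mem_sup_inf R L L' (corootOrth P) hLC
    (fun y hy => exists_smul_mem_span_classWt eX' hTm'.2.1 hLC' hy)
    (fun φ hφR hφL => addMonoidHom_eq_zero_of_forall_classWt eX hTm.2.1 φ (fun s => hφR _ (hR s))
      (fun i => hφL _ (Submodule.subset_span ⟨i, rfl⟩))) x
  refine ⟨M, hM0, fun t' ht' => ?_⟩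
  obtain ⟨r, hr, l, hl, hrl⟩ := Submodule.mem_sup.1 hM
  rw [← MonoidHom.zpow_apply, ← charOfWeight_zsmul, ← hrl, charOfWeight_add', MonoidHom.mul_apply,
    charOfWeight_eq_one_of_inr_mem_of_mem_rootSpan h h' b hG hTm hG' hTm' ht' hr,
    charOfWeight_eq_one_of_mem_inf h h' hG.1.1 hG'.1.1 hR _ ht' hl.1 hl.2, one_mul]

include hG hG' in
/-- **`Lie(H)_0` is a graph over its first block**: if `A ∈ Lie(H)` has `T̃`-weight `0` and
`A₁₁ = 0`, then `A = 0`. With `A = diag(0, z')`, `z' ∈ Lie(T')`, diagonalise `T'` by `g'`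
(`torusFrame`), so `g' z' g'⁻¹ = diag(s')`; the hull torus of `diag(0, s')` lies in
`diag(1, g') H diag(1, g')⁻¹` (`hullTorus_le_of_diagonal_mem_lieAlgebraGL`), consists of elements
`diag(1, δ)` with `δ` in the hull torus of `diag(s')`, which lies in `g' T' g'⁻¹`; thus
`(1, g'⁻¹ δ g') ∈ H` with `g'⁻¹ δ g' ∈ T'`, and by `exists_forall_charOfWeight_zpow_eq_one` the
`j`-th entry of `δ` (the value of the coordinate character) satisfies `δ_j^{M_j} = 1`; hence the
monomial character `t ↦ t_{jj}^{M_j}` is trivial on the hull torus and `M_j s'_j = 0`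
(`zdot_eq_zero_of_forall_mem_hullTorus`). [cite: SpringerLAG1998, 9.6.2] -/
theorem eq_zero_of_mem_lieAlgebraGL_graphGroup_zero_of_toBlocks₁₁ {A : Matrix (n ⊕ n') (n ⊕ n') k}
    (hA : A ∈ lieAlgebraGL (graphGroup h h' hTm.2.1 hTm'.2.1 (b.support : Set ι)))
    (hw : A ∈ grW eX eX' hTm.2.1 hTm'.2.1 0) (h0 : A.toBlocks₁₁ = 0) : A = 0 := by
  set H := graphGroup h h' hTm.2.1 hTm'.2.1 (b.support : Set ι) with hH
  have hT' : IsTorusSubgroup T' := hTm'.2.1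
  obtain ⟨eA, -, hz'⟩ := mem_lieAlgebraGL_graphGroup_weight_zero eX eX' h h' hG hTm hG' hTm' hA hw
  set z' : Matrix n' n' k := A.toBlocks₂₂ with hz'def
  set g' : GL n' k := torusFrame hT' with hg'
  have hd : T'.map (MulAut.conj g' : GL n' k →* GL n' k) ≤ diagonalSubgroup n' k := torusFrame_spec hT'
  have hz₀ : (g' : Matrix n' n' k) * z' * ((g'⁻¹ : GL n' k) : Matrix n' n' k) ∈
      lieAlgebraGL (T'.map (MulAut.conj g' : GL n' k →* GL n' k)) :=
    (mem_lieAlgebraGL_map_conj_iff g').2 hz'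
  obtain ⟨s', hs'⟩ := exists_eq_diagonal_of_mem_lieAlgebraGL hd hz₀
  -- it suffices that `s' = 0`
  suffices hs0 : s' = 0 by
    have hz'0 : z' = 0 := by
      calc z' = ((g'⁻¹ : GL n' k) : Matrix n' n' k) * ((g' : Matrix n' n' k) * z' * ((g'⁻¹ : GL n' k) : Matrix n' n' k)) *
            (g' : Matrix n' n' k) := (units_inv_conj_conj g' z').symm
        _ = 0 := by rw [hs', hs0]; simp
    rw [eA, h0, hz'0, fromBlocks_zero]
  funext j
  -- the conjugated graph group and the hull tori
  set σ : n ⊕ n' → k := Sum.elim 0 s' with hσdef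
  set gt : GL (n ⊕ n') k := blockDiagGL ((1 : GL n k), g') with hgt
  have hHalg : IsAlgebraicSubgroup (H.map (MulAut.conj gt : GL (n ⊕ n') k →* GL (n ⊕ n') k)) :=
    (isAlgebraicSubgroup_graphGroup h h' hTm.2.1 hTm'.2.1 _).map_conj' gt
  have hσ : Matrix.diagonal σ ∈ lieAlgebraGL (H.map (MulAut.conj gt : GL (n ⊕ n') k →* GL (n ⊕ n') k)) := by
    have e : (gt : Matrix (n ⊕ n') (n ⊕ n') k) * A * ((gt⁻¹ : GL (n ⊕ n') k) : Matrix (n ⊕ n') (n ⊕ n') k) =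
        Matrix.diagonal σ := by
      rw [eA, h0, hgt, coe_blockDiagGL, coe_blockDiagGL_inv, fromBlocks_multiply, fromBlocks_multiply]
      simp only [Matrix.mul_zero, Matrix.zero_mul, add_zero, zero_add, Units.val_one]
      rw [hs', hσdef, ← fromBlocks_diagonal]
      simp
    rw [← e]
    exact conj_mem_lieAlgebraGL_map_conj gt hA
  have hhull : hullTorus σ ≤ H.map (MulAut.conj gt : GL (n ⊕ n') k →* GL (n ⊕ n') k) :=
    hullTorus_le_of_diagonal_mem_lieAlgebraGL hHalg hσ
  have hT'alg : IsAlgebraicSubgroup (T'.map (MulAut.conj g' : GL n' k →* GL n' k)) := hT'.1.1.map_conj' g'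
  have hσ' : Matrix.diagonal s' ∈ lieAlgebraGL (T'.map (MulAut.conj g' : GL n' k →* GL n' k)) := hs' ▸ hz₀
  have hhull' : hullTorus s' ≤ T'.map (MulAut.conj g' : GL n' k →* GL n' k) :=
    hullTorus_le_of_diagonal_mem_lieAlgebraGL hT'alg hσ'
  -- the exponent for the coordinate weight `wt'_j`
  obtain ⟨M, hM0, hM⟩ := exists_forall_charOfWeight_zpow_eq_one h h' b hG hTm hG' hTm' (coordWt eX' hT' j)
  -- the monomial character `t ↦ t_{jj}^M` is trivial on the hull torus of `σ`
  have key : zdot (Pi.single (Sum.inr j) M : n ⊕ n' → ℤ) σ = 0 := by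
    refine zdot_eq_zero_of_forall_mem_hullTorus σ fun d hdmem => ?_
    have hmemσ := (diagonalGL_mem_hullTorus_iff σ d).1 hdmem
    -- (i) the `n`-entries of `d` are `1`
    have hd1 : ∀ i, d (Sum.inl i) = 1 := by
      intro i
      have := hmemσ (Pi.single (Sum.inl i) 1) (by rw [zdot_single, hσdef, Sum.elim_inl, Pi.zero_apply])
      rwa [Finset.prod_eq_single (Sum.inl i) (fun l _ hl => by rw [Pi.single_eq_of_ne hl, zpow_zero])
        (fun hi => absurd (Finset.mem_univ _) hi), Pi.single_eq_same, zpow_one] at this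
    -- (ii) the `n'`-part `δ` lies in the hull torus of `s'`
    have hδ : diagonalGL n' k (fun j => d (Sum.inr j)) ∈ hullTorus s' := by
      rw [diagonalGL_mem_hullTorus_iff]
      intro a' ha'
      have hz : zdot (Sum.elim 0 a') σ = 0 := by
        rw [zdot, Fintype.sum_sum_type]
        simp only [hσdef, Sum.elim_inl, Sum.elim_inr, Pi.zero_apply, mul_zero, Finset.sum_const_zero, zero_add]
        exact ha'
      have := hmemσ (Sum.elim 0 a') hz
      rwa [Fintype.prod_sum_type, Finset.prod_eq_one (fun i _ => by rw [Sum.elim_inl, Pi.zero_apply, zpow_zero]),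
        one_mul] at this
    -- (iii) `δ = g' t₀ g'⁻¹` with `t₀ ∈ T'`
    obtain ⟨t₀, ht₀, ht₀e⟩ := Subgroup.mem_map.1 (hhull' hδ)
    -- (iv) `diag(d) = gt (1, t₀) gt⁻¹`, so `(1, t₀) ∈ H`
    have hdiag : diagonalGL (n ⊕ n') k d = blockDiagGL ((1 : GL n k), diagonalGL n' k fun j => d (Sum.inr j)) := by
      apply Units.ext
      rw [coe_diagonalGL, coe_blockDiagGL, coe_diagonalGL, Units.val_one, ← Matrix.diagonal_one, fromBlocks_diagonal]
      congr 1
      funext l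
      rcases l with i | j
      · rw [Sum.elim_inl, hd1 i, Units.val_one]
      · rw [Sum.elim_inr]
    have hmemH : blockDiagGL ((1 : GL n k), (t₀ : GL n' k)) ∈ H := by
      obtain ⟨x, hx, hxe⟩ := Subgroup.mem_map.1 (hhull hdmem)
      have hxe' : x = blockDiagGL ((1 : GL n k), (t₀ : GL n' k)) := by
        apply (MulAut.conj gt).injective
        change MulAut.conj gt x = _ at hxe
        rw [hxe, hdiag, MulAut.conj_apply, hgt, ← map_inv, ← map_mul, ← map_mul]
        congr 1
        refine Prod.ext (by simp) ?_
        simp only [Prod.snd_mul, Prod.snd_inv]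
        change _ = (MulAut.conj g' : GL n' k →* GL n' k) t₀
        rw [ht₀e]
      rw [← hxe']
      exact hx
    -- (v) the coordinate character: `coordChar_j(t₀) = d_{inr j}`, and its `M`-th power is `1`
    have hchar := hM ⟨t₀, ht₀⟩ hmemH
    rw [charOfWeight_coordWt] at hchar
    have hcd : coordChar hT' j ⟨t₀, ht₀⟩ = d (Sum.inr j) := by
      have e1 := conj_coe_eq_diagonal hT' ⟨t₀, ht₀⟩
      have e2 : (g' : Matrix n' n' k) * ((t₀ : GL n' k) : Matrix n' n' k) * ((g'⁻¹ : GL n' k) : Matrix n' n' k) =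
          Matrix.diagonal fun j => ((d (Sum.inr j) : kˣ) : k) := by
        have := congrArg (fun u : GL n' k => (u : Matrix n' n' k)) ht₀e
        simp only [MonoidHom.coe_coe, MulAut.conj_apply, Units.val_mul, coe_diagonalGL] at this
        exact this
      have e3 := congrFun (congrFun (e1.symm.trans e2) j) j
      rw [Matrix.diagonal_apply_eq, Matrix.diagonal_apply_eq] at e3
      exact Units.ext e3
    rw [Finset.prod_eq_single (Sum.inr j) (fun l _ hl => by rw [Pi.single_eq_of_ne hl, zpow_zero])
      (fun hj => absurd (Finset.mem_univ _) hj), Pi.single_eq_same, ← hcd]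
    exact hchar
  -- conclude `s' j = 0`
  have hMs : (M : k) * s' j = 0 := by
    rw [zdot, Finset.sum_eq_single (Sum.inr j) (fun l _ hl => by rw [Pi.single_eq_of_ne hl, Int.cast_zero, zero_mul])
      (fun hj => absurd (Finset.mem_univ _) hj), Pi.single_eq_same, hσdef, Sum.elim_inr] at key
    exact key
  exact (mul_eq_zero.1 hMs).resolve_left (Int.cast_ne_zero.2 hM0)

include hG hG' in
/-- **`Lie(H)_0` is a graph over its second block**: if `A ∈ Lie(H)` has `T̃`-weight `0` and
`A₂₂ = 0`, then `A = 0` (take `B ∈ Lie(T̃)` with `B₁₁ = A₁₁`,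
`exists_mem_lieAlgebraGL_graphTorus_toBlocks₁₁_eq`; then `A - B ∈ Lie(H)_0` has first block `0`,
so `A = B`, and `B₂₂ = 0` forces `B = 0`). [cite: SpringerLAG1998, 9.6.2] -/
theorem eq_zero_of_mem_lieAlgebraGL_graphGroup_zero_of_toBlocks₂₂ {A : Matrix (n ⊕ n') (n ⊕ n') k}
    (hA : A ∈ lieAlgebraGL (graphGroup h h' hTm.2.1 hTm'.2.1 (b.support : Set ι)))
    (hw : A ∈ grW eX eX' hTm.2.1 hTm'.2.1 0) (h0 : A.toBlocks₂₂ = 0) : A = 0 := by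
  obtain ⟨-, hz, -⟩ := mem_lieAlgebraGL_graphGroup_weight_zero eX eX' h h' hG hTm hG' hTm' hA hw
  obtain ⟨B, hB, hB₁⟩ := exists_mem_lieAlgebraGL_graphTorus_toBlocks₁₁_eq eX eX' hTm.2.1 hTm'.2.1 hz
  have hBH : B ∈ lieAlgebraGL (graphGroup h h' hTm.2.1 hTm'.2.1 (b.support : Set ι)) :=
    lieAlgebraGL_mono (graphTorus_le_graphGroup h h' _ _ _) hB
  have hBw : B ∈ grW eX eX' hTm.2.1 hTm'.2.1 0 := lieAlgebraGL_graphTorus_le_grW_zero eX eX' _ _ hB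
  have hAB : A - B = 0 := by
    refine eq_zero_of_mem_lieAlgebraGL_graphGroup_zero_of_toBlocks₁₁ h h' b hG hTm hG' hTm'
      (Submodule.sub_mem _ hA hBH) (Submodule.sub_mem _ hw hBw) ?_
    have e : (A - B).toBlocks₁₁ = A.toBlocks₁₁ - B.toBlocks₁₁ := by ext i j; rfl
    rw [e, hB₁, sub_self]
  have hAeq : A = B := sub_eq_zero.1 hAB
  subst hAeq
  exact eq_zero_of_mem_lieAlgebraGL_graphTorus_of_toBlocks₂₂ eX eX' _ _ hB h0

include hG hG' in
/-- **`Lie(H)_0 = Lie(T̃)`.** [cite: SpringerLAG1998, 9.6.2] -/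
theorem mem_lieAlgebraGL_graphTorus_of_mem_zero {A : Matrix (n ⊕ n') (n ⊕ n') k}
    (hA : A ∈ lieAlgebraGL (graphGroup h h' hTm.2.1 hTm'.2.1 (b.support : Set ι)))
    (hw : A ∈ grW eX eX' hTm.2.1 hTm'.2.1 0) : A ∈ lieAlgebraGL (graphTorus eX eX' hTm.2.1 hTm'.2.1) := by
  obtain ⟨-, hz, -⟩ := mem_lieAlgebraGL_graphGroup_weight_zero eX eX' h h' hG hTm hG' hTm' hA hw
  obtain ⟨B, hB, hB₁⟩ := exists_mem_lieAlgebraGL_graphTorus_toBlocks₁₁_eq eX eX' hTm.2.1 hTm'.2.1 hz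
  have hBH : B ∈ lieAlgebraGL (graphGroup h h' hTm.2.1 hTm'.2.1 (b.support : Set ι)) :=
    lieAlgebraGL_mono (graphTorus_le_graphGroup h h' _ _ _) hB
  have hBw : B ∈ grW eX eX' hTm.2.1 hTm'.2.1 0 := lieAlgebraGL_graphTorus_le_grW_zero eX eX' _ _ hB
  have hAB : A - B = 0 := by
    refine eq_zero_of_mem_lieAlgebraGL_graphGroup_zero_of_toBlocks₁₁ h h' b hG hTm hG' hTm'
      (Submodule.sub_mem _ hA hBH) (Submodule.sub_mem _ hw hBw) ?_
    have e : (A - B).toBlocks₁₁ = A.toBlocks₁₁ - B.toBlocks₁₁ := by ext i j; rfl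
    rw [e, hB₁, sub_self]
  rw [sub_eq_zero.1 hAB]
  exact hB

end Central

end Literature.NumberTheory.Automorphic

end
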